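import Mathlib.Analysis.InnerProductSpace.l2Space
import Mathlib.Analysis.InnerProductSpace.Adjoint
import Mathlib.Data.Finsupp.Weight
import Literature.MathematicalPhysics.QuantumManyBody.TorusBoseFockLayer
import HarnessLib

/-!
# The bosonic Fock space in the occupation-number basis, its truncations `𝓕^{≤N}` and the
# modified creation/annihilation operators `b_p, b_p^*` of Boccato–Brennecke–Cenatiempo–Schlein

Topic `Literature/MathematicalPhysics/QuantumManyBody`, namespace `BoseGas.Fock` (the completed,
Hilbert-space companion of layer A of `TorusBoseFockLayer.lean`, whose finite-excitation model is
`MvPolynomial ι ℂ` with the Bargmann inner product `fockInner`, `⟨X^d, X^e⟩ = d! δ_{d,e}`). Written for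
the provefact `Literature.MathematicalPhysics.QuantumManyBody.BoseGas.BoccatoEtAl2019Acta_firstExcitation`
([BoccatoEtAl2019Acta, Thm. 1.1]): §2 of the source ("Fock space") is the setting of its whole proof —
the truncated excitation Fock space `𝓕_+^{≤N} = ⊕_{n ≤ N} L²_⊥(Λ)^{⊗_s n}` and the modified fields
`b_p = √((N-𝒩_+)/N) a_p`, `b_p^* = a_p^* √((N-𝒩_+)/N)` [BoccatoEtAl2019Acta, (2.2)] with their
commutation relations [ibid., (2.3)].

**Model.** For a set of modes `ι` (for the source: `ι = Λ*_+ = 2πℤ³∖{0}`, so that the Fock space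
over `ι` IS `𝓕_+`; no orthogonality condition is needed), the bosonic Fock space in the
occupation-number basis is `FockSpace ι = ℓ²(ι →₀ ℕ; ℂ)` (Mathlib's `lp … 2`, a Hilbert space): the
orthonormal basis vector `|d⟩ = occBasis d` (`d : ι →₀ ℕ`, `d p` = number of particles in mode `p`)
corresponds to `(d!)^{-1/2} ∏_p (a_p^*)^{d_p} Ω`, i.e. to `X^d/√(d!)` in the polynomial model. The
`n`-particle sectors are the `d` of degree `|d| = ∑_p d_p = n` (`Finsupp.degree`), and the truncated
space `truncFock ι N = 𝓕^{≤N}` is the closed subspace of vectors supported on `|d| ≤ N`.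

**Operators as bounded weighted shifts.** Every operator of the source that preserves `𝓕_+^{≤N}`
acts in the occupation basis as a *weighted shift* `(Tξ)(d) = w(d) ξ(σ d)` with a bounded weight;
`weightedShift w σ` packages these as bounded operators on all of `FockSpace ι` (vanishing where the
source's operator would leave `𝓕^{≤N}`), with the generic norm bound `‖T‖ ≤ sup |w|`
(`norm_weightedShift_le`). Instances (all depending on the truncation parameter `N`):
* `numberCLM N` — `𝒩_+` on `𝓕_+^{≤N}`: `𝒩|d⟩ = |d| |d⟩` (`|d| ≤ N`);
* `annOp N p` — `a_p` on `𝓕^{≤N}`: `(a_p ξ)(d) = √(d_p + 1) ξ(d + e_p)`; `crAnOp N p q` — `a_p^* a_q`;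
* `bAnnih N p`, `bCreate N p` — the **modified fields** `b_p = √((N - 𝒩)/N) a_p`, `b_p^* = a_p^* √((N - 𝒩)/N)`
  [BoccatoEtAl2019Acta, (2.2)]: `(b_p ξ)(d) = √((N - |d|)/N) √(d_p + 1) ξ(d + e_p)`,
  `(b_p^* ξ)(d) = √(d_p) √((N + 1 - |d|)/N) ξ(d - e_p)` (`d_p ≥ 1`, `|d| ≤ N`).
Proved: the actions on basis vectors, the norm bounds `‖a_p‖, ‖b_p‖, ‖b_p^*‖ ≤ √N`, `‖a_p^* a_q‖ ≤ N`
on `𝓕^{≤N}` [ibid., (2.1): `‖a(f)ξ‖ ≤ ‖f‖ ‖𝒩^{1/2}ξ‖`], invariance of `𝓕^{≤N}`, `b_p^*` is the adjoint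
of `b_p` (`bCreate_eq_adjoint_bAnnih`), that `𝓕^{≤N}` is the closed span of its basis vectors
(`truncFock_subset_closure_span`, `eqOn_truncFock_of_eqOn_occBasis`), and the **commutation relation
(2.3)** on `𝓕^{≤N}`: `[b_p, b_q^*] = (1 - 𝒩/N) δ_{p,q} - N⁻¹ a_q^* a_p` (`commutator_bAnnih_bCreate`). The
remaining relations of (2.3)–(2.6) (`[b_p, b_q] = 0`, `[b_p, a_q^* a_r] = δ_{p,q} b_r`, …) follow the
same pattern and are left to the sequel.

## References
* [BoccatoEtAl2019Acta] Boccato–Brennecke–Cenatiempo–Schlein, Acta Math. 222 (2019), §2, (2.1)–(2.3).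
* [LSSY2005] Lieb–Seiringer–Solovej–Yngvason, *The Mathematics of the Bose Gas* (2005), App. A
  (occupation-number representation, (A.7)–(A.11)).
-/

noncomputable section

open Filter Set Function
open scoped ENNReal NNReal ComplexConjugate InnerProductSpace

namespace Literature.MathematicalPhysics.QuantumManyBody.BoseGas.Fock

variable {ι : Type*}

/-! ### The Fock space `ℓ²(ι →₀ ℕ)` -/

/-- **The bosonic Fock space over the modes `ι` in the occupation-number basis**: square-summable
amplitudes `ξ(d)`, `d : ι →₀ ℕ` an occupation configuration. A Hilbert space (Mathlib's `ℓ²`).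
[cite: LSSY2005, App. A (A.9)–(A.11)] -/
abbrev FockSpace (ι : Type*) : Type _ := lp (fun _ : (ι →₀ ℕ) => ℂ) 2

/-- `0 < (2 : ℝ≥0∞).toReal`. [folklore] -/
theorem two_toReal_pos : 0 < (2 : ℝ≥0∞).toReal := by norm_num

/-- The amplitudes of a Fock vector are square summable. [folklore] -/
theorem summable_norm_sq (ξ : FockSpace ι) : Summable fun d => ‖ξ d‖ ^ 2 := by
  have h := (lp.memℓp ξ)
  rw [memℓp_gen_iff two_toReal_pos] at h
  simpa [Real.rpow_two] using h

/-- `‖ξ‖² = ∑_d ‖ξ(d)‖²`. [folklore] -/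
theorem norm_sq_eq_tsum (ξ : FockSpace ι) : ‖ξ‖ ^ 2 = ∑' d, ‖ξ d‖ ^ 2 := by
  have h := lp.norm_rpow_eq_tsum two_toReal_pos ξ
  simpa [Real.rpow_two] using h

/-! ### Weighted shifts -/

section WeightedShift

variable (w : (ι →₀ ℕ) → ℂ) (σ : (ι →₀ ℕ) → (ι →₀ ℕ))

/-- Square summability of a weighted shifted amplitude: if `σ` is injective where `w ≠ 0` and
`|w| ≤ C`, then `∑_d |w(d) ξ(σ d)|² ≤ C² ‖ξ‖²`. [folklore] -/
theorem tsum_sq_weightedShift_le (hσ : InjOn σ {d | w d ≠ 0}) {C : ℝ} (hw : ∀ d, ‖w d‖ ≤ C)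
    (ξ : FockSpace ι) :
    Summable (fun d => ‖w d * ξ (σ d)‖ ^ 2) ∧ ∑' d, ‖w d * ξ (σ d)‖ ^ 2 ≤ C ^ 2 * ‖ξ‖ ^ 2 := by
  classical
  -- restrict to the support of `w`, where `σ` is injective
  set S : Set (ι →₀ ℕ) := {d | w d ≠ 0} with hS
  have hξ := summable_norm_sq ξ
  have hinj : Injective (fun d : S => σ d) := fun a b h => Subtype.ext (hσ a.2 b.2 h)
  have h1 : Summable fun d : S => ‖ξ (σ d)‖ ^ 2 := hξ.comp_injective hinj
  have hle1 : ∑' d : S, ‖ξ (σ d)‖ ^ 2 ≤ ∑' d, ‖ξ d‖ ^ 2 :=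
    tsum_comp_le_tsum_of_inj hξ (fun _ => by positivity) hinj
  -- the function vanishes off `S`
  have hvan : ∀ d, d ∉ S → ‖w d * ξ (σ d)‖ ^ 2 = 0 := fun d hd => by
    simp only [hS, mem_setOf_eq, not_not] at hd
    simp [hd]
  have hbound : ∀ d : S, ‖w d * ξ (σ d)‖ ^ 2 ≤ C ^ 2 * ‖ξ (σ d)‖ ^ 2 := fun d => by
    rw [norm_mul, mul_pow]
    exact mul_le_mul_of_nonneg_right (pow_le_pow_left₀ (norm_nonneg _) (hw d) 2) (by positivity)
  have h2 : Summable fun d : S => ‖w d * ξ (σ d)‖ ^ 2 :=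
    (h1.mul_left (C ^ 2)).of_nonneg_of_le (fun _ => by positivity) hbound
  have hind : S.indicator (fun d => ‖w d * ξ (σ d)‖ ^ 2) = fun d => ‖w d * ξ (σ d)‖ ^ 2 := by
    funext d
    by_cases hd : d ∈ S
    · rw [indicator_of_mem hd]
    · rw [indicator_of_notMem hd, hvan d hd]
  have h3 : Summable fun d => ‖w d * ξ (σ d)‖ ^ 2 := by
    rw [← hind]; exact summable_subtype_iff_indicator.1 h2
  refine ⟨h3, ?_⟩
  calc ∑' d, ‖w d * ξ (σ d)‖ ^ 2 = ∑' d, S.indicator (fun d => ‖w d * ξ (σ d)‖ ^ 2) d := by rw [hind]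
    _ = ∑' d : S, ‖w d * ξ (σ d)‖ ^ 2 := (tsum_subtype S _).symm
    _ ≤ ∑' d : S, C ^ 2 * ‖ξ (σ d)‖ ^ 2 := h2.tsum_le_tsum hbound (h1.mul_left _)
    _ = C ^ 2 * ∑' d : S, ‖ξ (σ d)‖ ^ 2 := tsum_mul_left
    _ ≤ C ^ 2 * ∑' d, ‖ξ d‖ ^ 2 := by gcongr
    _ = C ^ 2 * ‖ξ‖ ^ 2 := by rw [norm_sq_eq_tsum]

/-- The weighted shift of a Fock vector is a Fock vector. [folklore] -/
theorem memℓp_weightedShift (hσ : InjOn σ {d | w d ≠ 0}) {C : ℝ} (hw : ∀ d, ‖w d‖ ≤ C)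
    (ξ : FockSpace ι) : Memℓp (fun d => w d * ξ (σ d)) 2 := by
  rw [memℓp_gen_iff two_toReal_pos]
  simpa [Real.rpow_two] using (tsum_sq_weightedShift_le w σ hσ hw ξ).1

/-- The weighted shift as a linear map. [folklore] -/
def weightedShiftₗ (hσ : InjOn σ {d | w d ≠ 0}) {C : ℝ} (hw : ∀ d, ‖w d‖ ≤ C) :
    FockSpace ι →ₗ[ℂ] FockSpace ι where
  toFun ξ := ⟨fun d => w d * ξ (σ d), memℓp_weightedShift w σ hσ hw ξ⟩
  map_add' ξ η := by
    ext d
    show w d * (ξ + η) (σ d) = w d * ξ (σ d) + w d * η (σ d)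
    rw [lp.coeFn_add, Pi.add_apply, mul_add]
  map_smul' c ξ := by
    ext d
    simp only [lp.coeFn_smul, Pi.smul_apply, smul_eq_mul, RingHom.id_apply]
    show w d * (c * ξ (σ d)) = c * (w d * ξ (σ d))
    ring

/-- **Weighted shifts are bounded operators on the Fock space**: for a weight `|w| ≤ C` and a
relabelling `σ` injective on the support of `w`, `(Tξ)(d) = w(d) ξ(σ d)` defines `T` with `‖T‖ ≤ C`.
All the number-preserving-or-lowering operators of [BoccatoEtAl2019Acta, §2] restricted to `𝓕^{≤N}`
are of this form in the occupation basis. [folklore] -/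
def weightedShift (hσ : InjOn σ {d | w d ≠ 0}) {C : ℝ} (hC : 0 ≤ C) (hw : ∀ d, ‖w d‖ ≤ C) :
    FockSpace ι →L[ℂ] FockSpace ι :=
  LinearMap.mkContinuous (weightedShiftₗ w σ hσ hw) C fun ξ => by
    refine lp.norm_le_of_tsum_le two_toReal_pos (by positivity) ?_
    have h := (tsum_sq_weightedShift_le w σ hσ hw ξ).2
    simp only [ENNReal.toReal_ofNat, Real.rpow_two, mul_pow]
    exact h

/-- The action of a weighted shift on amplitudes. [folklore] -/
@[simp] theorem weightedShift_apply (hσ : InjOn σ {d | w d ≠ 0}) {C : ℝ} (hC : 0 ≤ C)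
    (hw : ∀ d, ‖w d‖ ≤ C) (ξ : FockSpace ι) (d : ι →₀ ℕ) :
    weightedShift w σ hσ hC hw ξ d = w d * ξ (σ d) := rfl

/-- The norm bound `‖T‖ ≤ C` of a weighted shift. [folklore] -/
theorem norm_weightedShift_le (hσ : InjOn σ {d | w d ≠ 0}) {C : ℝ} (hC : 0 ≤ C) (hw : ∀ d, ‖w d‖ ≤ C) :
    ‖weightedShift w σ hσ hC hw‖ ≤ C :=
  LinearMap.mkContinuous_norm_le _ hC _

/-- The pointwise norm bound `‖Tξ‖ ≤ C‖ξ‖`. [folklore] -/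
theorem norm_weightedShift_apply_le (hσ : InjOn σ {d | w d ≠ 0}) {C : ℝ} (hC : 0 ≤ C)
    (hw : ∀ d, ‖w d‖ ≤ C) (ξ : FockSpace ι) : ‖weightedShift w σ hσ hC hw ξ‖ ≤ C * ‖ξ‖ :=
  (weightedShift w σ hσ hC hw).le_of_opNorm_le (norm_weightedShift_le w σ hσ hC hw) ξ

end WeightedShift

/-! ### Coordinates, the occupation basis, the vacuum -/

/-- The amplitude functional `ξ ↦ ξ(d)` (bounded by `1`). [folklore] -/
def coord (d : ι →₀ ℕ) : FockSpace ι →L[ℂ] ℂ :=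
  LinearMap.mkContinuous
    { toFun := fun ξ => ξ d
      map_add' := fun ξ η => by rw [lp.coeFn_add, Pi.add_apply]
      map_smul' := fun c ξ => by rw [lp.coeFn_smul, Pi.smul_apply, RingHom.id_apply] }
    1 fun ξ => by simpa using lp.norm_apply_le_norm two_ne_zero ξ d

/-- `coord d ξ = ξ d`. [folklore] -/
@[simp] theorem coord_apply (d : ι →₀ ℕ) (ξ : FockSpace ι) : coord d ξ = ξ d := rfl

/-- The amplitude `ξ ↦ ξ(d)` is continuous. [folklore] -/
theorem continuous_apply_fock (d : ι →₀ ℕ) : Continuous fun ξ : FockSpace ι => ξ d :=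
  (coord d).continuous

section Basis

variable [DecidableEq ι]

/-- **The occupation-number basis vector** `|d⟩` (`= (d!)^{-1/2} ∏_p (a_p^*)^{d_p} Ω = X^d/√(d!)` in
the polynomial model). [cite: LSSY2005, App. A (A.9)] -/
def occBasis (d : ι →₀ ℕ) : FockSpace ι := lp.single 2 d (1 : ℂ)

/-- The amplitudes of `|d⟩`. [folklore] -/
theorem occBasis_apply (d e : ι →₀ ℕ) : occBasis d e = if e = d then 1 else 0 := by
  rw [occBasis, lp.single_apply, Pi.single_apply]

/-- `|d⟩(d) = 1`. [folklore] -/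
@[simp] theorem occBasis_apply_self (d : ι →₀ ℕ) : occBasis d d = 1 := by
  rw [occBasis_apply, if_pos rfl]

/-- `|d⟩(e) = 0` for `e ≠ d`. [folklore] -/
theorem occBasis_apply_ne {d e : ι →₀ ℕ} (h : e ≠ d) : occBasis d e = 0 := by
  rw [occBasis_apply, if_neg h]

/-- **The vacuum** `Ω = |0⟩`. [cite: BoccatoEtAl2019Acta, §2 ("Ω = {1, 0, …}")] -/
def vacuum : FockSpace ι := occBasis 0

/-- `⟨d|ξ⟩ = ξ(d)`. [folklore] -/
theorem inner_occBasis_left (d : ι →₀ ℕ) (ξ : FockSpace ι) : ⟪occBasis d, ξ⟫_ℂ = ξ d := by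
  rw [occBasis, lp.inner_single_left]
  simp

/-- The occupation basis is orthonormal. [folklore] -/
theorem orthonormal_occBasis : Orthonormal ℂ (occBasis : (ι →₀ ℕ) → FockSpace ι) := by
  rw [orthonormal_iff_ite]
  intro d e
  rw [inner_occBasis_left, occBasis_apply]

/-- The action of a weighted shift on a basis vector is read off at one amplitude:
`(T|d⟩)(e) = w(e) [σ e = d]`. [folklore] -/
theorem weightedShift_occBasis_apply (w : (ι →₀ ℕ) → ℂ) (σ : (ι →₀ ℕ) → (ι →₀ ℕ))
    (hσ : InjOn σ {d | w d ≠ 0}) {C : ℝ} (hC : 0 ≤ C) (hw : ∀ d, ‖w d‖ ≤ C) (d e : ι →₀ ℕ) :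
    weightedShift w σ hσ hC hw (occBasis d) e = if σ e = d then w e else 0 := by
  rw [weightedShift_apply, occBasis_apply]
  split_ifs <;> simp

end Basis

/-! ### The truncated Fock space `𝓕^{≤N}` -/

/-- **The truncated Fock space** `𝓕^{≤N}`: vectors supported on configurations with at most `N`
particles, `|d| = ∑_p d_p ≤ N` (the closed span of the sectors `n ≤ N`).
[cite: BoccatoEtAl2019Acta, §2 (`𝓕_+^{≤N} = ⊕_{n=0}^N L²_⊥(Λ)^{⊗_s n}`)] -/
def truncFock (ι : Type*) (N : ℕ) : Submodule ℂ (FockSpace ι) where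
  carrier := {ξ | ∀ d : ι →₀ ℕ, N < d.degree → ξ d = 0}
  zero_mem' := fun _ _ => rfl
  add_mem' := by
    intro ξ η hξ hη d hd
    rw [lp.coeFn_add, Pi.add_apply, hξ d hd, hη d hd, add_zero]
  smul_mem' := by
    intro c ξ hξ d hd
    rw [lp.coeFn_smul, Pi.smul_apply, hξ d hd, smul_zero]

/-- Membership in `𝓕^{≤N}`. [folklore] -/
theorem mem_truncFock {N : ℕ} {ξ : FockSpace ι} :
    ξ ∈ truncFock ι N ↔ ∀ d : ι →₀ ℕ, N < d.degree → ξ d = 0 := Iff.rfl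

/-- `𝓕^{≤N}` is closed. [folklore] -/
theorem isClosed_truncFock (ι : Type*) (N : ℕ) : IsClosed (truncFock ι N : Set (FockSpace ι)) := by
  have : (truncFock ι N : Set (FockSpace ι)) = ⋂ d ∈ {d : ι →₀ ℕ | N < d.degree}, {ξ | ξ d = 0} := by
    ext ξ
    simp only [SetLike.mem_coe, mem_truncFock, mem_iInter, mem_setOf_eq]
  rw [this]
  exact isClosed_biInter fun d _ => isClosed_eq (continuous_apply_fock d) continuous_const

/-- `𝓕^{≤N}` is complete (a Hilbert space). [folklore] -/
instance instCompleteSpaceTruncFock (ι : Type*) (N : ℕ) : CompleteSpace (truncFock ι N) :=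
  (isClosed_truncFock ι N).completeSpace_coe

/-- `𝓕^{≤N} ⊆ 𝓕^{≤M}` for `N ≤ M`. [folklore] -/
theorem truncFock_mono (ι : Type*) {N M : ℕ} (h : N ≤ M) : truncFock ι N ≤ truncFock ι M :=
  fun _ hξ d hd => hξ d (lt_of_le_of_lt h hd)

/-- Basis vectors with at most `N` particles lie in `𝓕^{≤N}`. [folklore] -/
theorem occBasis_mem_truncFock [DecidableEq ι] {N : ℕ} {d : ι →₀ ℕ} (h : d.degree ≤ N) :
    occBasis d ∈ truncFock ι N := fun e he =>
  occBasis_apply_ne fun hed => by subst hed; exact absurd h (not_le.2 he)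

/-- A weighted shift whose weight vanishes above `N` particles maps into `𝓕^{≤N}`. [folklore] -/
theorem weightedShift_mem_truncFock (w : (ι →₀ ℕ) → ℂ) (σ : (ι →₀ ℕ) → (ι →₀ ℕ))
    (hσ : InjOn σ {d | w d ≠ 0}) {C : ℝ} (hC : 0 ≤ C) (hw : ∀ d, ‖w d‖ ≤ C) {N : ℕ}
    (hN : ∀ d, N < d.degree → w d = 0) (ξ : FockSpace ι) :
    weightedShift w σ hσ hC hw ξ ∈ truncFock ι N := fun d hd => by
  rw [weightedShift_apply, hN d hd, zero_mul]

/-! ### The operators of [BoccatoEtAl2019Acta, §2] on `𝓕^{≤N}` -/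

section Operators

variable (N : ℕ)

/-- Degree bookkeeping: `|d + e_p| = |d| + 1`. [folklore] -/
theorem degree_add_single (d : ι →₀ ℕ) (p : ι) : (d + Finsupp.single p 1).degree = d.degree + 1 := by
  rw [map_add, Finsupp.degree_single]

/-- `d - e_p + e_p = d` when `d_p ≥ 1`. [folklore] -/
theorem tsub_single_add_single {d : ι →₀ ℕ} {p : ι} (h : 1 ≤ d p) :
    d - Finsupp.single p 1 + Finsupp.single p 1 = d := by
  ext q
  rcases eq_or_ne q p with rfl | hq
  · simp only [Finsupp.coe_add, Pi.add_apply, Finsupp.coe_tsub, Pi.sub_apply, Finsupp.single_eq_same]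
    omega
  · simp only [Finsupp.coe_add, Pi.add_apply, Finsupp.coe_tsub, Pi.sub_apply,
      Finsupp.single_eq_of_ne hq]
    omega

/-- Degree bookkeeping: `|d - e_p| = |d| - 1` when `d_p ≥ 1`. [folklore] -/
theorem degree_tsub_single {d : ι →₀ ℕ} {p : ι} (h : 1 ≤ d p) :
    (d - Finsupp.single p 1).degree = d.degree - 1 := by
  have : d = (d - Finsupp.single p 1) + Finsupp.single p 1 := (tsub_single_add_single h).symm
  conv_rhs => rw [this, degree_add_single]
  omega

/-- `d + e_p - e_p = d`. [folklore] -/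
theorem add_single_tsub_single (d : ι →₀ ℕ) (p : ι) :
    d + Finsupp.single p 1 - Finsupp.single p 1 = d := by
  ext q
  rcases eq_or_ne q p with rfl | hq
  · simp only [Finsupp.coe_add, Pi.add_apply, Finsupp.coe_tsub, Pi.sub_apply, Finsupp.single_eq_same]
    omega
  · simp only [Finsupp.coe_add, Pi.add_apply, Finsupp.coe_tsub, Pi.sub_apply,
      Finsupp.single_eq_of_ne hq]
    omega

/-- `d_p ≤ |d|`. [folklore] -/
theorem apply_le_degree (d : ι →₀ ℕ) (p : ι) : d p ≤ d.degree := Finsupp.le_degree p d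

/-- The weight of `𝒩` on `𝓕^{≤N}`: `|d|` (and `0` above `N`). [cite: BoccatoEtAl2019Acta, §2 (`𝒩_+`)] -/
def numberWeight (d : ι →₀ ℕ) : ℂ := if d.degree ≤ N then (d.degree : ℂ) else 0

/-- `|numberWeight| ≤ N`. [folklore] -/
theorem norm_numberWeight_le (d : ι →₀ ℕ) : ‖numberWeight N d‖ ≤ N := by
  unfold numberWeight
  split_ifs with h
  · rw [Complex.norm_natCast]; exact_mod_cast h
  · rw [norm_zero]; exact Nat.cast_nonneg N

/-- **The number operator `𝒩` on `𝓕^{≤N}`**: `𝒩|d⟩ = |d| |d⟩` for `|d| ≤ N` (zero above `N`).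
[cite: BoccatoEtAl2019Acta, §2 (`𝒩_+ = ∑ a_p^* a_p`)] -/
def numberCLM : FockSpace ι →L[ℂ] FockSpace ι :=
  weightedShift (numberWeight (ι := ι) N) id (injOn_id _) (Nat.cast_nonneg N) (norm_numberWeight_le N)

/-- The amplitudes of `𝒩ξ`. [folklore] -/
theorem numberCLM_apply (ξ : FockSpace ι) (d : ι →₀ ℕ) :
    numberCLM N ξ d = (if d.degree ≤ N then (d.degree : ℂ) else 0) * ξ d := rfl

/-- The weight of `a_p` on `𝓕^{≤N}`: `√(d_p + 1)` when `|d| < N`. [cite: LSSY2005, App. A (A.7)–(A.8)] -/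
def annWeight (p : ι) (d : ι →₀ ℕ) : ℂ := if d.degree < N then ((Real.sqrt (d p + 1) : ℝ) : ℂ) else 0

/-- `|annWeight| ≤ √N`. [folklore] -/
theorem norm_annWeight_le (p : ι) (d : ι →₀ ℕ) : ‖annWeight N p d‖ ≤ Real.sqrt N := by
  unfold annWeight
  split_ifs with h
  · rw [Complex.norm_real, Real.norm_of_nonneg (Real.sqrt_nonneg _)]
    refine Real.sqrt_le_sqrt ?_
    have := apply_le_degree d p
    exact_mod_cast (by omega : d p + 1 ≤ N)
  · rw [norm_zero]; exact Real.sqrt_nonneg _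

/-- The relabelling of `a_p` / `b_p`: `d ↦ d + e_p`. [folklore] -/
def annShift (p : ι) (d : ι →₀ ℕ) : ι →₀ ℕ := d + Finsupp.single p 1

/-- `d ↦ d + e_p` is injective. [folklore] -/
theorem annShift_injective (p : ι) : Injective (annShift (ι := ι) p) :=
  add_left_injective _

/-- **The annihilation operator `a_p` on `𝓕^{≤N}`**: `(a_p ξ)(d) = √(d_p + 1) ξ(d + e_p)` for
`|d| < N` (as a bounded operator of norm `≤ √N` vanishing above the truncation).
[cite: BoccatoEtAl2019Acta, §2 (2.1)] -/
def annOp (p : ι) : FockSpace ι →L[ℂ] FockSpace ι :=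
  weightedShift (annWeight N p) (annShift p) ((annShift_injective p).injOn) (Real.sqrt_nonneg N)
    (norm_annWeight_le N p)

/-- The amplitudes of `a_p ξ`. [folklore] -/
theorem annOp_apply (p : ι) (ξ : FockSpace ι) (d : ι →₀ ℕ) :
    annOp N p ξ d = (if d.degree < N then ((Real.sqrt (d p + 1) : ℝ) : ℂ) else 0) *
      ξ (d + Finsupp.single p 1) := rfl

/-- `‖a_p‖ ≤ √N` on `𝓕^{≤N}`. [cite: BoccatoEtAl2019Acta, §2 (2.1)] -/
theorem norm_annOp_le (p : ι) : ‖annOp (ι := ι) N p‖ ≤ Real.sqrt N :=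
  norm_weightedShift_le _ _ _ _ _

/-- The weight of the modified annihilation operator `b_p = √((N-𝒩)/N) a_p`:
`√((N - |d|)/N) √(d_p + 1)` when `|d| < N`. [cite: BoccatoEtAl2019Acta, (2.2)] -/
def bAnnWeight (p : ι) (d : ι →₀ ℕ) : ℂ :=
  if d.degree < N then ((Real.sqrt ((N - d.degree) / N) * Real.sqrt (d p + 1) : ℝ) : ℂ) else 0

/-- `|bAnnWeight| ≤ √N`. [folklore] -/
theorem norm_bAnnWeight_le (p : ι) (d : ι →₀ ℕ) : ‖bAnnWeight N p d‖ ≤ Real.sqrt N := by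
  unfold bAnnWeight
  split_ifs with h
  · rw [Complex.norm_real, Real.norm_of_nonneg (by positivity)]
    have h1 : Real.sqrt ((N - d.degree) / N) ≤ 1 := by
      rw [Real.sqrt_le_one]
      have hN : (0 : ℝ) < N := by exact_mod_cast (Nat.zero_lt_of_lt h)
      rw [div_le_one hN]
      have : (d.degree : ℝ) ≥ 0 := Nat.cast_nonneg _
      linarith
    have h2 : Real.sqrt (d p + 1) ≤ Real.sqrt N := by
      refine Real.sqrt_le_sqrt ?_
      have := apply_le_degree d p
      exact_mod_cast (by omega : d p + 1 ≤ N)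
    calc Real.sqrt ((N - d.degree) / N) * Real.sqrt (d p + 1) ≤ 1 * Real.sqrt N := by
          gcongr
      _ = Real.sqrt N := one_mul _
  · rw [norm_zero]; exact Real.sqrt_nonneg _

/-- **The modified annihilation operator `b_p = √((N - 𝒩)/N) a_p` on `𝓕^{≤N}`**:
`(b_p ξ)(d) = √((N - |d|)/N) √(d_p + 1) ξ(d + e_p)` for `|d| < N`. [cite: BoccatoEtAl2019Acta, (2.2)] -/
def bAnnih (p : ι) : FockSpace ι →L[ℂ] FockSpace ι :=
  weightedShift (bAnnWeight N p) (annShift p) ((annShift_injective p).injOn) (Real.sqrt_nonneg N)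
    (norm_bAnnWeight_le N p)

/-- The amplitudes of `b_p ξ`. [folklore] -/
theorem bAnnih_apply (p : ι) (ξ : FockSpace ι) (d : ι →₀ ℕ) :
    bAnnih N p ξ d = (if d.degree < N then
      ((Real.sqrt ((N - d.degree) / N) * Real.sqrt (d p + 1) : ℝ) : ℂ) else 0) *
      ξ (d + Finsupp.single p 1) := rfl

/-- `‖b_p‖ ≤ √N` on `𝓕^{≤N}`. [cite: BoccatoEtAl2019Acta, §2 (2.1)–(2.2)] -/
theorem norm_bAnn_le (p : ι) : ‖bAnnih (ι := ι) N p‖ ≤ Real.sqrt N :=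
  norm_weightedShift_le _ _ _ _ _

/-- The weight of the modified creation operator `b_p^* = a_p^* √((N-𝒩)/N)`:
`√(d_p) √((N + 1 - |d|)/N)` when `d_p ≥ 1` and `|d| ≤ N`. [cite: BoccatoEtAl2019Acta, (2.2)] -/
def bCrWeight (p : ι) (d : ι →₀ ℕ) : ℂ :=
  if 1 ≤ d p ∧ d.degree ≤ N then ((Real.sqrt (d p) * Real.sqrt ((N + 1 - d.degree) / N) : ℝ) : ℂ) else 0

/-- The relabelling of creation-type operators: `d ↦ d - e_p`. [folklore] -/
def crShift (p : ι) (d : ι →₀ ℕ) : ι →₀ ℕ := d - Finsupp.single p 1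

/-- `d ↦ d - e_p` is injective on `{d_p ≥ 1}`. [folklore] -/
theorem crShift_injOn (p : ι) : InjOn (crShift (ι := ι) p) {d | 1 ≤ d p} := by
  intro d hd e he h
  have := congrArg (· + Finsupp.single p 1) h
  simp only [crShift, tsub_single_add_single (show 1 ≤ d p from hd),
    tsub_single_add_single (show 1 ≤ e p from he)] at this
  exact this

/-- `|bCrWeight| ≤ √N`. [folklore] -/
theorem norm_bCrWeight_le (p : ι) (d : ι →₀ ℕ) : ‖bCrWeight N p d‖ ≤ Real.sqrt N := by
  unfold bCrWeight
  split_ifs with h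
  · rw [Complex.norm_real, Real.norm_of_nonneg (by positivity)]
    have hdeg : 1 ≤ d.degree := h.1.trans (apply_le_degree d p)
    have hN : (0 : ℝ) < N := by exact_mod_cast (lt_of_lt_of_le hdeg h.2)
    have h1 : Real.sqrt (d p) ≤ Real.sqrt N :=
      Real.sqrt_le_sqrt (by exact_mod_cast (apply_le_degree d p).trans h.2)
    have h2 : Real.sqrt ((N + 1 - d.degree) / N) ≤ 1 := by
      rw [Real.sqrt_le_one, div_le_one hN]
      have : (1 : ℝ) ≤ d.degree := by exact_mod_cast hdeg
      linarith
    calc Real.sqrt (d p) * Real.sqrt ((N + 1 - d.degree) / N) ≤ Real.sqrt N * 1 := by gcongr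
      _ = Real.sqrt N := mul_one _
  · rw [norm_zero]; exact Real.sqrt_nonneg _

/-- The support of `bCrWeight` lies in `{d_p ≥ 1}`. [folklore] -/
theorem bCrWeight_ne_zero {p : ι} {d : ι →₀ ℕ} (h : bCrWeight N p d ≠ 0) : 1 ≤ d p := by
  unfold bCrWeight at h
  split_ifs at h with h'
  · exact h'.1
  · exact absurd rfl h

/-- **The modified creation operator `b_p^* = a_p^* √((N - 𝒩)/N)` on `𝓕^{≤N}`**:
`(b_p^* ξ)(d) = √(d_p) √((N + 1 - |d|)/N) ξ(d - e_p)` for `d_p ≥ 1`, `|d| ≤ N`.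
[cite: BoccatoEtAl2019Acta, (2.2)] -/
def bCreate (p : ι) : FockSpace ι →L[ℂ] FockSpace ι :=
  weightedShift (bCrWeight N p) (crShift p) ((crShift_injOn p).mono fun _ hd => bCrWeight_ne_zero N hd)
    (Real.sqrt_nonneg N) (norm_bCrWeight_le N p)

/-- The amplitudes of `b_p^* ξ`. [folklore] -/
theorem bCreate_apply (p : ι) (ξ : FockSpace ι) (d : ι →₀ ℕ) :
    bCreate N p ξ d = (if 1 ≤ d p ∧ d.degree ≤ N then
      ((Real.sqrt (d p) * Real.sqrt ((N + 1 - d.degree) / N) : ℝ) : ℂ) else 0) *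
      ξ (d - Finsupp.single p 1) := rfl

/-- `‖b_p^*‖ ≤ √N` on `𝓕^{≤N}`. [cite: BoccatoEtAl2019Acta, §2 (2.1)–(2.2)] -/
theorem norm_bCr_le (p : ι) : ‖bCreate (ι := ι) N p‖ ≤ Real.sqrt N :=
  norm_weightedShift_le _ _ _ _ _

/-- The weight of `a_p^* a_q` on `𝓕^{≤N}`: `√(d_p) √((d - e_p + e_q)_q)` when `d_p ≥ 1`, `|d| ≤ N`.
[cite: BoccatoEtAl2019Acta, §2] -/
def crAnWeight (p q : ι) (d : ι →₀ ℕ) : ℂ :=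
  if 1 ≤ d p ∧ d.degree ≤ N then
    ((Real.sqrt (d p) * Real.sqrt (((d - Finsupp.single p 1 + Finsupp.single q 1 : ι →₀ ℕ) q : ℕ)) : ℝ) : ℂ) else 0

/-- The relabelling of `a_p^* a_q`: `d ↦ d - e_p + e_q`. [folklore] -/
def crAnShift (p q : ι) (d : ι →₀ ℕ) : ι →₀ ℕ := d - Finsupp.single p 1 + Finsupp.single q 1

/-- `d ↦ d - e_p + e_q` is injective on `{d_p ≥ 1}`. [folklore] -/
theorem crAnShift_injOn (p q : ι) : InjOn (crAnShift (ι := ι) p q) {d | 1 ≤ d p} := by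
  intro d hd e he h
  exact crShift_injOn p hd he (add_left_injective _ h)

/-- `|crAnWeight| ≤ N`. [folklore] -/
theorem norm_crAnWeight_le (p q : ι) (d : ι →₀ ℕ) : ‖crAnWeight N p q d‖ ≤ N := by
  unfold crAnWeight
  split_ifs with h
  · rw [Complex.norm_real, Real.norm_of_nonneg (by positivity)]
    have h1 : Real.sqrt (d p) ≤ Real.sqrt N :=
      Real.sqrt_le_sqrt (by exact_mod_cast (apply_le_degree d p).trans h.2)
    have hdeg' : (d - Finsupp.single p 1 + Finsupp.single q 1).degree = d.degree := by
      rw [degree_add_single, degree_tsub_single h.1]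
      have := h.1.trans (apply_le_degree d p)
      omega
    have h2 : Real.sqrt (((d - Finsupp.single p 1 + Finsupp.single q 1 : ι →₀ ℕ) q : ℕ)) ≤ Real.sqrt N := by
      refine Real.sqrt_le_sqrt ?_
      have := apply_le_degree (d - Finsupp.single p 1 + Finsupp.single q 1 : ι →₀ ℕ) q
      rw [hdeg'] at this
      exact_mod_cast this.trans h.2
    calc Real.sqrt (d p) * Real.sqrt (((d - Finsupp.single p 1 + Finsupp.single q 1 : ι →₀ ℕ) q : ℕ))
        ≤ Real.sqrt N * Real.sqrt N := by gcongr
      _ = N := Real.mul_self_sqrt (Nat.cast_nonneg N)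
  · rw [norm_zero]; exact Nat.cast_nonneg N

/-- The support of `crAnWeight` lies in `{d_p ≥ 1}`. [folklore] -/
theorem crAnWeight_ne_zero {p q : ι} {d : ι →₀ ℕ} (h : crAnWeight N p q d ≠ 0) : 1 ≤ d p := by
  unfold crAnWeight at h
  split_ifs at h with h'
  · exact h'.1
  · exact absurd rfl h

/-- **The number-preserving quadratic operator `a_p^* a_q` on `𝓕^{≤N}`**:
`(a_p^* a_q ξ)(d) = √(d_p) √((d - e_p + e_q)_q) ξ(d - e_p + e_q)` for `d_p ≥ 1`, `|d| ≤ N`.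
[cite: BoccatoEtAl2019Acta, §2] -/
def crAnOp (p q : ι) : FockSpace ι →L[ℂ] FockSpace ι :=
  weightedShift (crAnWeight N p q) (crAnShift p q)
    ((crAnShift_injOn p q).mono fun _ hd => crAnWeight_ne_zero N hd) (Nat.cast_nonneg N)
    (norm_crAnWeight_le N p q)

/-- The amplitudes of `a_p^* a_q ξ`. [folklore] -/
theorem crAnOp_apply (p q : ι) (ξ : FockSpace ι) (d : ι →₀ ℕ) :
    crAnOp N p q ξ d = (if 1 ≤ d p ∧ d.degree ≤ N then
      ((Real.sqrt (d p) * Real.sqrt (((d - Finsupp.single p 1 + Finsupp.single q 1 : ι →₀ ℕ) q : ℕ)) : ℝ) : ℂ)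
      else 0) * ξ (d - Finsupp.single p 1 + Finsupp.single q 1) := rfl

/-- `‖a_p^* a_q‖ ≤ N` on `𝓕^{≤N}`. [cite: BoccatoEtAl2019Acta, §2 (2.1)] -/
theorem norm_crAnOp_le (p q : ι) : ‖crAnOp (ι := ι) N p q‖ ≤ N :=
  norm_weightedShift_le _ _ _ _ _

/-! #### Invariance of `𝓕^{≤N}` -/

/-- `𝒩` preserves `𝓕^{≤N}`. [folklore] -/
theorem numberCLM_mem_truncFock (ξ : FockSpace ι) : numberCLM N ξ ∈ truncFock ι N :=
  weightedShift_mem_truncFock _ _ _ _ _ (fun d hd => by simp [numberWeight, not_le.2 hd]) ξ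

/-- `a_p` maps into `𝓕^{≤N}` (indeed into `𝓕^{≤N-1}`). [folklore] -/
theorem annOp_mem_truncFock (p : ι) (ξ : FockSpace ι) : annOp N p ξ ∈ truncFock ι N :=
  weightedShift_mem_truncFock _ _ _ _ _ (fun d hd => by
    simp [annWeight, not_lt.2 (le_of_lt hd)]) ξ

/-- `b_p` maps into `𝓕^{≤N}`. [cite: BoccatoEtAl2019Acta, §2 ("`b(f), b^*(f) : 𝓕_+^{≤N} → 𝓕_+^{≤N}`")] -/
theorem bAnnih_mem_truncFock (p : ι) (ξ : FockSpace ι) : bAnnih N p ξ ∈ truncFock ι N :=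
  weightedShift_mem_truncFock _ _ _ _ _ (fun d hd => by
    simp [bAnnWeight, not_lt.2 (le_of_lt hd)]) ξ

/-- `b_p^*` maps into `𝓕^{≤N}`. [cite: BoccatoEtAl2019Acta, §2 ("`b(f), b^*(f) : 𝓕_+^{≤N} → 𝓕_+^{≤N}`")] -/
theorem bCreate_mem_truncFock (p : ι) (ξ : FockSpace ι) : bCreate N p ξ ∈ truncFock ι N :=
  weightedShift_mem_truncFock _ _ _ _ _ (fun d hd => by
    simp [bCrWeight, not_le.2 hd]) ξ

/-- `a_p^* a_q` maps into `𝓕^{≤N}`. [folklore] -/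
theorem crAnOp_mem_truncFock (p q : ι) (ξ : FockSpace ι) : crAnOp N p q ξ ∈ truncFock ι N :=
  weightedShift_mem_truncFock _ _ _ _ _ (fun d hd => by
    simp [crAnWeight, not_le.2 hd]) ξ

end Operators

/-! ### Adjoints of weighted shifts; `b_p^*` is the adjoint of `b_p` -/

section Adjoint

variable {w w' : (ι →₀ ℕ) → ℂ} {σ σ' : (ι →₀ ℕ) → (ι →₀ ℕ)}

/-- **Adjoint criterion for weighted shifts.** If the non-zero matrix elements of `(w, σ)` and
`(w', σ')` are in bijection — `w(d) ≠ 0 ∧ σ d = e ↔ w'(e) ≠ 0 ∧ σ' e = d` — with conjugate weights,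
then the weighted shift of `(w', σ')` is the Hilbert-space adjoint of that of `(w, σ)`. [folklore] -/
theorem weightedShift_eq_adjoint (hσ : InjOn σ {d | w d ≠ 0}) {C : ℝ} (hC : 0 ≤ C) (hw : ∀ d, ‖w d‖ ≤ C)
    (hσ' : InjOn σ' {d | w' d ≠ 0}) {C' : ℝ} (hC' : 0 ≤ C') (hw' : ∀ d, ‖w' d‖ ≤ C')
    (h : ∀ d e, (w d ≠ 0 ∧ σ d = e) ↔ (w' e ≠ 0 ∧ σ' e = d))
    (hconj : ∀ d, w d ≠ 0 → w' (σ d) = conj (w d)) :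
    weightedShift w' σ' hσ' hC' hw' = ContinuousLinearMap.adjoint (weightedShift w σ hσ hC hw) := by
  rw [ContinuousLinearMap.eq_adjoint_iff]
  intro η ξ
  rw [lp.inner_eq_tsum, lp.inner_eq_tsum]
  simp only [weightedShift_apply, RCLike.inner_apply']
  -- the bijection between the supports
  have hS : ∀ d, w d ≠ 0 → w' (σ d) ≠ 0 ∧ σ' (σ d) = d := fun d hd => (h d (σ d)).1 ⟨hd, rfl⟩
  have hS' : ∀ e, w' e ≠ 0 → w (σ' e) ≠ 0 ∧ σ (σ' e) = e := fun e he => (h (σ' e) e).2 ⟨he, rfl⟩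
  let E : {d // w d ≠ 0} ≃ {e // w' e ≠ 0} :=
    { toFun := fun d => ⟨σ d, (hS d d.2).1⟩
      invFun := fun e => ⟨σ' e, (hS' e e.2).1⟩
      left_inv := fun d => Subtype.ext (hS d d.2).2
      right_inv := fun e => Subtype.ext (hS' e e.2).2 }
  set f : (ι →₀ ℕ) → ℂ := fun e => conj (w' e * η (σ' e)) * ξ e with hf
  set g : (ι →₀ ℕ) → ℂ := fun d => conj (η d) * (w d * ξ (σ d)) with hg
  have hfsupp : support f ⊆ {e | w' e ≠ 0} := by
    intro e he
    simp only [mem_support, hf] at he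
    intro h0
    apply he
    rw [h0, zero_mul, map_zero, zero_mul]
  have hgsupp : support g ⊆ {d | w d ≠ 0} := by
    intro d hd
    simp only [mem_support, hg] at hd
    intro h0
    apply hd
    rw [h0, zero_mul, mul_zero]
  calc ∑' e, f e = ∑' e : {e // w' e ≠ 0}, f e := (tsum_subtype_eq_of_support_subset hfsupp).symm
    _ = ∑' d : {d // w d ≠ 0}, f (E d) := (Equiv.tsum_eq E (fun e => f e)).symm
    _ = ∑' d : {d // w d ≠ 0}, g d := tsum_congr fun d => by
        simp only [hf, hg, E, Equiv.coe_fn_mk, (hS d d.2).2, hconj d d.2, map_mul, Complex.conj_conj]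
        ring
    _ = ∑' d, g d := tsum_subtype_eq_of_support_subset hgsupp

variable (N : ℕ)

/-- **`b_p^*` is the adjoint of `b_p`** on the Fock space (the matrix elements
`⟨d - e_p| b_p |d⟩‾ = ⟨d| b_p^* |d - e_p⟩` are real and equal). [cite: BoccatoEtAl2019Acta, (2.2)] -/
theorem bCreate_eq_adjoint_bAnnih (p : ι) : bCreate (ι := ι) N p = ContinuousLinearMap.adjoint (bAnnih N p) := by
  refine weightedShift_eq_adjoint _ _ _ _ _ _ (fun d e => ?_) (fun d hd => ?_)
  · constructor
    · rintro ⟨hd, rfl⟩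
      have hlt : d.degree < N := by
        by_contra hge; exact hd (by simp [bAnnWeight, hge])
      refine ⟨?_, add_single_tsub_single d p⟩
      simp only [bCrWeight, annShift, Finsupp.coe_add, Pi.add_apply, Finsupp.single_eq_same,
        degree_add_single]
      rw [if_pos ⟨by omega, by omega⟩]
      have h1 : (0 : ℝ) < Real.sqrt ((d p + 1 : ℕ) : ℝ) := Real.sqrt_pos.2 (by positivity)
      have h2 : (0 : ℝ) < Real.sqrt ((N + 1 - (d.degree + 1 : ℕ) : ℝ) / N) := by
        apply Real.sqrt_pos.2
        apply div_pos
        · push_cast; have : (d.degree : ℝ) + 1 ≤ N := by exact_mod_cast hlt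
          linarith
        · exact_mod_cast Nat.zero_lt_of_lt hlt
      exact_mod_cast (mul_pos h1 h2).ne'
    · rintro ⟨he, rfl⟩
      have hcond : 1 ≤ e p ∧ e.degree ≤ N := by
        by_contra hc; exact he (by simp [bCrWeight, hc])
      refine ⟨?_, tsub_single_add_single hcond.1⟩
      simp only [bAnnWeight, crShift, degree_tsub_single hcond.1]
      have hdeg : 1 ≤ e.degree := hcond.1.trans (apply_le_degree e p)
      rw [if_pos (by omega)]
      have h1 : (0 : ℝ) < Real.sqrt ((N - (e.degree - 1 : ℕ) : ℝ) / N) := by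
        apply Real.sqrt_pos.2
        apply div_pos
        · have : ((e.degree - 1 : ℕ) : ℝ) < N := by exact_mod_cast (by omega : e.degree - 1 < N)
          linarith
        · exact_mod_cast (lt_of_lt_of_le hdeg hcond.2 : 0 < N)
      have h2 : (0 : ℝ) < Real.sqrt (((e - Finsupp.single p 1 : ι →₀ ℕ) p + 1 : ℕ) : ℝ) :=
        Real.sqrt_pos.2 (by positivity)
      exact_mod_cast (mul_pos h1 h2).ne'
  · -- conjugate (indeed equal, real) weights
    have hlt : d.degree < N := by
      by_contra hge; exact hd (by simp [bAnnWeight, hge])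
    simp only [bCrWeight, bAnnWeight, annShift, Finsupp.coe_add, Pi.add_apply, Finsupp.single_eq_same,
      degree_add_single, if_pos hlt]
    rw [if_pos ⟨by omega, by omega⟩, Complex.conj_ofReal]
    congr 1
    push_cast
    ring_nf

end Adjoint

/-! ### Actions on the occupation basis -/

section BasisActions

variable [DecidableEq ι] (N : ℕ)

/-- `𝒩|d⟩ = |d| |d⟩` for `|d| ≤ N`. [cite: BoccatoEtAl2019Acta, §2] -/
theorem numberCLM_occBasis {d : ι →₀ ℕ} (hd : d.degree ≤ N) :
    numberCLM N (occBasis d) = (d.degree : ℂ) • occBasis d := by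
  refine lp.ext (funext fun e => ?_)
  rw [numberCLM, weightedShift_occBasis_apply, lp.coeFn_smul, Pi.smul_apply, occBasis_apply, smul_eq_mul]
  simp only [id_eq, numberWeight]
  split_ifs with h1 h2
  · subst h1; simp
  · subst h1; exact absurd hd h2
  · simp

/-- `b_p |d⟩ = √(d_p) √((N + 1 - |d|)/N) |d - e_p⟩` for `d_p ≥ 1`, `|d| ≤ N` (and `0` if `d_p = 0`).
[cite: BoccatoEtAl2019Acta, (2.2)] -/
theorem bAnnih_occBasis (p : ι) {d : ι →₀ ℕ} (hd : d.degree ≤ N) (hp : 1 ≤ d p) :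
    bAnnih N p (occBasis d) =
      (((Real.sqrt ((N + 1 - d.degree) / N) * Real.sqrt (d p) : ℝ) : ℂ)) • occBasis (d - Finsupp.single p 1) := by
  refine lp.ext (funext fun e => ?_)
  rw [bAnnih, weightedShift_occBasis_apply, lp.coeFn_smul, Pi.smul_apply, occBasis_apply, smul_eq_mul]
  simp only [annShift]
  by_cases he : e = d - Finsupp.single p 1
  · subst he
    rw [if_pos (tsub_single_add_single hp), if_pos rfl, mul_one, bAnnWeight, degree_tsub_single hp]
    have hdeg : 1 ≤ d.degree := hp.trans (apply_le_degree d p)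
    rw [if_pos (by omega)]
    congr 1
    have e1 : ((N : ℝ) - ((d.degree - 1 : ℕ) : ℝ)) = (N + 1 - d.degree) := by
      push_cast [Nat.cast_sub hdeg]; ring
    have e2 : (((d - Finsupp.single p 1 : ι →₀ ℕ) p : ℕ) : ℝ) + 1 = d p := by
      simp only [Finsupp.coe_tsub, Pi.sub_apply, Finsupp.single_eq_same]
      push_cast [Nat.cast_sub hp]; ring
    rw [e1, e2]
  · rw [if_neg, if_neg he, mul_zero]
    intro h
    apply he
    rw [← h, add_single_tsub_single]

/-- `b_p |d⟩ = 0` if `d_p = 0`. [cite: BoccatoEtAl2019Acta, (2.2)] -/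
theorem bAnnih_occBasis_of_eq_zero (p : ι) {d : ι →₀ ℕ} (hp : d p = 0) : bAnnih N p (occBasis d) = 0 := by
  refine lp.ext (funext fun e => ?_)
  rw [bAnnih, weightedShift_occBasis_apply, lp.coeFn_zero, Pi.zero_apply, if_neg]
  intro h
  have := congrArg (fun f : ι →₀ ℕ => f p) h
  simp only [annShift, Finsupp.coe_add, Pi.add_apply, Finsupp.single_eq_same, hp] at this
  omega

/-- `b_p^* |d⟩ = √(d_p + 1) √((N - |d|)/N) |d + e_p⟩` for `|d| < N`. [cite: BoccatoEtAl2019Acta, (2.2)] -/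
theorem bCreate_occBasis (p : ι) {d : ι →₀ ℕ} (hd : d.degree < N) :
    bCreate N p (occBasis d) =
      (((Real.sqrt (d p + 1) * Real.sqrt ((N - d.degree) / N) : ℝ) : ℂ)) • occBasis (d + Finsupp.single p 1) := by
  refine lp.ext (funext fun e => ?_)
  rw [bCreate, weightedShift_occBasis_apply, lp.coeFn_smul, Pi.smul_apply, occBasis_apply, smul_eq_mul]
  simp only [crShift]
  by_cases he : e = d + Finsupp.single p 1
  · subst he
    rw [if_pos (add_single_tsub_single d p), if_pos rfl, mul_one, bCrWeight, degree_add_single]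
    simp only [Finsupp.coe_add, Pi.add_apply, Finsupp.single_eq_same]
    rw [if_pos ⟨by omega, by omega⟩]
    congr 1
    push_cast
    ring_nf
  · rw [if_neg he, mul_zero]
    split_ifs with h
    · by_cases h1 : 1 ≤ e p
      · exfalso
        apply he
        rw [← h, tsub_single_add_single h1]
      · simp [bCrWeight, h1]
    · rfl

/-- `b_p^* |d⟩ = 0` on the top sector `|d| = N` (and above). [cite: BoccatoEtAl2019Acta, (2.2)] -/
theorem bCreate_occBasis_of_le (p : ι) {d : ι →₀ ℕ} (hd : N ≤ d.degree) : bCreate N p (occBasis d) = 0 := by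
  refine lp.ext (funext fun e => ?_)
  rw [bCreate, weightedShift_occBasis_apply, lp.coeFn_zero, Pi.zero_apply]
  split_ifs with h
  · simp only [bCrWeight]
    rw [if_neg]
    rintro ⟨h1, h2⟩
    have : e.degree = d.degree + 1 := by
      rw [← h, crShift, degree_tsub_single h1]
      have := h1.trans (apply_le_degree e p)
      omega
    omega
  · rfl

end BasisActions


/-! ### The basis vectors span `𝓕^{≤N}`; more basis actions -/

section Span

variable [DecidableEq ι] (N : ℕ)

/-- `𝓕^{≤N}` lies in the closed span of the basis vectors `|d⟩`, `|d| ≤ N` (indeed it is that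
closed span): every `ξ ∈ 𝓕^{≤N}` is the `ℓ²`-sum `∑_d ξ(d)|d⟩` of such vectors. [folklore] -/
theorem truncFock_subset_closure_span :
    (truncFock ι N : Set (FockSpace ι)) ⊆
      closure (Submodule.span ℂ (occBasis '' {d : ι →₀ ℕ | d.degree ≤ N}) : Set (FockSpace ι)) := by
  intro ξ hξ
  have hsum := lp.hasSum_single ENNReal.ofNat_ne_top ξ
  refine mem_closure_of_tendsto hsum (Eventually.of_forall fun F => ?_)
  refine Submodule.sum_mem _ fun d _ => ?_
  by_cases hd : d.degree ≤ N
  · have : lp.single 2 d (ξ d : ℂ) = (ξ d : ℂ) • occBasis d := by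
      rw [occBasis, ← lp.single_smul, smul_eq_mul, mul_one]
    rw [this]
    exact Submodule.smul_mem _ _ (Submodule.subset_span ⟨d, hd, rfl⟩)
  · rw [show (ξ d : ℂ) = 0 from hξ d (not_le.1 hd)]
    have : (lp.single 2 d (0 : ℂ) : FockSpace ι) = 0 := by
      refine lp.ext (funext fun e => ?_)
      rw [lp.single_apply, Pi.single_apply, lp.coeFn_zero, Pi.zero_apply]
      split_ifs <;> rfl
    rw [this]
    exact Submodule.zero_mem _

/-- **Two bounded operators that agree on the basis vectors `|d⟩`, `|d| ≤ N`, agree on `𝓕^{≤N}`.**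
[folklore] -/
theorem eqOn_truncFock_of_eqOn_occBasis {T S : FockSpace ι →L[ℂ] FockSpace ι}
    (h : ∀ d : ι →₀ ℕ, d.degree ≤ N → T (occBasis d) = S (occBasis d)) :
    EqOn T S (truncFock ι N) := by
  intro ξ hξ
  refine ContinuousLinearMap.eqOn_closure_span (s := occBasis '' {d : ι →₀ ℕ | d.degree ≤ N}) ?_
    (truncFock_subset_closure_span N hξ)
  rintro v ⟨d, hd, rfl⟩
  exact h d hd

/-- `a_p^* a_q |d⟩ = √(d_q) √((d - e_q + e_p)_p) |d - e_q + e_p⟩` for `d_q ≥ 1`, `|d| ≤ N`.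
[cite: BoccatoEtAl2019Acta, §2] -/
theorem crAnOp_occBasis (p q : ι) {d : ι →₀ ℕ} (hd : d.degree ≤ N) (hq : 1 ≤ d q) :
    crAnOp N p q (occBasis d) =
      (((Real.sqrt (((d - Finsupp.single q 1 + Finsupp.single p 1 : ι →₀ ℕ) p : ℕ)) * Real.sqrt (d q) : ℝ) : ℂ)) •
        occBasis (d - Finsupp.single q 1 + Finsupp.single p 1) := by
  refine lp.ext (funext fun e => ?_)
  rw [crAnOp, weightedShift_occBasis_apply, lp.coeFn_smul, Pi.smul_apply, occBasis_apply, smul_eq_mul]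
  simp only [crAnShift]
  by_cases he : e = d - Finsupp.single q 1 + Finsupp.single p 1
  · subst he
    have hp1 : 1 ≤ (d - Finsupp.single q 1 + Finsupp.single p 1 : ι →₀ ℕ) p := by
      simp only [Finsupp.coe_add, Pi.add_apply, Finsupp.single_eq_same]; omega
    have hback : d - Finsupp.single q 1 + Finsupp.single p 1 - Finsupp.single p 1 + Finsupp.single q 1 = d := by
      rw [add_single_tsub_single, tsub_single_add_single hq]
    have hdeg : (d - Finsupp.single q 1 + Finsupp.single p 1 : ι →₀ ℕ).degree = d.degree := by
      rw [degree_add_single, degree_tsub_single hq]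
      have := hq.trans (apply_le_degree d q); omega
    rw [if_pos hback, if_pos rfl, mul_one, crAnWeight, if_pos ⟨hp1, hdeg ▸ hd⟩, hback]
  · rw [if_neg he, mul_zero]
    split_ifs with h
    · by_cases h1 : 1 ≤ e p
      · exfalso; apply he
        rw [← h, add_single_tsub_single, tsub_single_add_single h1]
      · simp [crAnWeight, h1]
    · rfl

/-- `a_p^* a_q |d⟩ = 0` if `d_q = 0`. [cite: BoccatoEtAl2019Acta, §2] -/
theorem crAnOp_occBasis_of_eq_zero (p q : ι) {d : ι →₀ ℕ} (hq : d q = 0) : crAnOp N p q (occBasis d) = 0 := by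
  refine lp.ext (funext fun e => ?_)
  rw [crAnOp, weightedShift_occBasis_apply, lp.coeFn_zero, Pi.zero_apply]
  split_ifs with h
  · by_cases h1 : 1 ≤ e p
    · exfalso
      have := congrArg (fun f : ι →₀ ℕ => f q) h
      simp only [crAnShift, Finsupp.coe_add, Finsupp.coe_tsub, Pi.add_apply, Pi.sub_apply,
        Finsupp.single_eq_same, hq] at this
      omega
    · simp [crAnWeight, h1]
  · rfl

end Span

/-! ### The commutation relations (2.3) on `𝓕^{≤N}` -/

section CCR

variable [DecidableEq ι] {N : ℕ}

omit [DecidableEq ι] in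
/-- `d + e_q - e_p = d - e_p + e_q` when `d_p ≥ 1`. [folklore] -/
theorem add_single_tsub_single_comm {d : ι →₀ ℕ} {p q : ι} (hp : 1 ≤ d p) :
    d + Finsupp.single q 1 - Finsupp.single p 1 = d - Finsupp.single p 1 + Finsupp.single q 1 := by
  ext r
  simp only [Finsupp.coe_add, Finsupp.coe_tsub, Pi.add_apply, Pi.sub_apply]
  rcases eq_or_ne r p with rfl | hrp
  · rw [Finsupp.single_eq_same]
    rcases eq_or_ne r q with rfl | hrq
    · rw [Finsupp.single_eq_same]; omega
    · rw [Finsupp.single_eq_of_ne hrq]; omega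
  · rw [Finsupp.single_eq_of_ne hrp]; omega

/-- Real-number bookkeeping for (2.3), diagonal case `p = q`, `|d| < N`:
`(d_p+1)(N-D)/N - d_p(N+1-D)/N = 1 - D/N - d_p/N`. [folklore] -/
theorem ccr_scalar_diag {Nr D a : ℝ} (hN : Nr ≠ 0) :
    (a + 1) * ((Nr - D) / Nr) - a * ((Nr + 1 - D) / Nr) = 1 - D / Nr - Nr⁻¹ * a := by
  field_simp
  ring

/-- Square roots of the shifted arguments appearing in (2.3). [folklore] -/
theorem sqrt_arg_simps (N D a : ℝ) :
    Real.sqrt ((N + 1 - (D + 1)) / N) = Real.sqrt ((N - D) / N) ∧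
    Real.sqrt ((N - (D - 1)) / N) = Real.sqrt ((N + 1 - D) / N) ∧
    Real.sqrt (a - 1 + 1) = Real.sqrt a := by
  refine ⟨?_, ?_, ?_⟩ <;> congr 1 <;> ring

/-- **The commutation relations `[b_p, b_q^*] = (1 - 𝒩_+/N) δ_{p,q} - N⁻¹ a_q^* a_p` on `𝓕_+^{≤N}`.**
Both sides are bounded operators on the Fock space; they agree on `𝓕^{≤N}` (checked on the basis
vectors `|d⟩`, `|d| ≤ N`, and extended by linearity and continuity). [cite: BoccatoEtAl2019Acta, (2.3)] -/
theorem commutator_bAnnih_bCreate (hN : 0 < N) (p q : ι) :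
    EqOn ((bAnnih N p ∘L bCreate N q - bCreate N q ∘L bAnnih N p : FockSpace ι →L[ℂ] FockSpace ι))
      (((if p = q then (1 : FockSpace ι →L[ℂ] FockSpace ι) - (N : ℂ)⁻¹ • numberCLM N else 0) -
        (N : ℂ)⁻¹ • crAnOp N q p : FockSpace ι →L[ℂ] FockSpace ι))
      (truncFock ι N) := by
  have hNr : (N : ℝ) ≠ 0 := by exact_mod_cast hN.ne'
  have hNpos : (0 : ℝ) < N := by exact_mod_cast hN
  refine eqOn_truncFock_of_eqOn_occBasis N fun d hd => ?_
  have hDle : (d.degree : ℝ) ≤ N := by exact_mod_cast hd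
  have key : ∀ (a b : ℂ) (v : FockSpace ι), a • v - b • v = (a - b) • v := fun a b v => (sub_smul a b v).symm
  -- the four square roots and their squares
  set A := Real.sqrt (d p + 1) with hA
  set B := Real.sqrt ((N - d.degree) / N) with hB
  set C := Real.sqrt ((N + 1 - d.degree) / N) with hC
  set E := Real.sqrt (d p) with hE
  set F := Real.sqrt (d q + 1) with hF
  have sA : A * A = d p + 1 := Real.mul_self_sqrt (by positivity)
  have sB : B * B = (N - d.degree) / N := Real.mul_self_sqrt (div_nonneg (by linarith) hNpos.le)
  have sC : C * C = (N + 1 - d.degree) / N := Real.mul_self_sqrt (div_nonneg (by linarith) hNpos.le)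
  have sE : E * E = d p := Real.mul_self_sqrt (by positivity)
  obtain ⟨r1, r2, r3⟩ := sqrt_arg_simps (N : ℝ) (d.degree : ℝ) (d p : ℝ)
  by_cases hpq : p = q
  · ----------------------------------------------------------------- diagonal case `p = q`
    subst hpq
    rw [if_pos rfl]
    show bAnnih N p (bCreate N p (occBasis d)) - bCreate N p (bAnnih N p (occBasis d)) =
      (occBasis d - (N : ℂ)⁻¹ • numberCLM N (occBasis d)) - (N : ℂ)⁻¹ • crAnOp N p p (occBasis d)
    rw [numberCLM_occBasis N hd]
    -- first product `b_p b_p^* |d⟩ = (A B)(B A) |d⟩` (or `0` on the top sector)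
    have hfirst : bAnnih N p (bCreate N p (occBasis d)) = (((A * B) * (B * A) : ℝ) : ℂ) • occBasis d := by
      rcases lt_or_eq_of_le hd with hD | hD
      · rw [bCreate_occBasis N p hD, map_smul, bAnnih_occBasis N p (by rw [degree_add_single]; omega)
          (by simp only [Finsupp.coe_add, Pi.add_apply, Finsupp.single_eq_same]; omega),
          add_single_tsub_single, smul_smul, ← Complex.ofReal_mul, mul_comm]
        congr 2
        simp only [degree_add_single, Finsupp.coe_add, Pi.add_apply, Finsupp.single_eq_same]
        push_cast
        rw [r1, hA, hB]
        ring
      · rw [bCreate_occBasis_of_le N p hD.ge, map_zero]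
        have hB0 : B = 0 := by rw [hB, hD, sub_self, zero_div, Real.sqrt_zero]
        rw [hB0, mul_zero, zero_mul, Complex.ofReal_zero, zero_smul]
    -- second product `b_p^* b_p |d⟩ = (C E)(E C) |d⟩` (or `0` if `d_p = 0`)
    have hsecond : bCreate N p (bAnnih N p (occBasis d)) = (((C * E) * (E * C) : ℝ) : ℂ) • occBasis d := by
      by_cases hp : 1 ≤ d p
      · have hdeg1 : 1 ≤ d.degree := hp.trans (apply_le_degree d p)
        rw [bAnnih_occBasis N p hd hp, map_smul,
          bCreate_occBasis N p (by rw [degree_tsub_single hp]; omega), tsub_single_add_single hp, smul_smul,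
          ← Complex.ofReal_mul, mul_comm]
        congr 2
        rw [degree_tsub_single hp]
        simp only [Finsupp.coe_tsub, Pi.sub_apply, Finsupp.single_eq_same]
        push_cast [Nat.cast_sub hp, Nat.cast_sub hdeg1]
        rw [r2, r3, hC, hE]
        ring
      · rw [not_le, Nat.lt_one_iff] at hp
        have hE0 : E = 0 := by rw [hE, hp, Nat.cast_zero, Real.sqrt_zero]
        rw [bAnnih_occBasis_of_eq_zero N p hp, map_zero, hE0, mul_zero, zero_mul, Complex.ofReal_zero, zero_smul]
    have hthird : crAnOp N p p (occBasis d) = (((E * E) : ℝ) : ℂ) • occBasis d := by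
      by_cases hp : 1 ≤ d p
      · rw [crAnOp_occBasis N p p hd hp, tsub_single_add_single hp]
      · rw [not_le, Nat.lt_one_iff] at hp
        have hE0 : E = 0 := by rw [hE, hp, Nat.cast_zero, Real.sqrt_zero]
        rw [crAnOp_occBasis_of_eq_zero N p p hp, hE0, mul_zero, Complex.ofReal_zero, zero_smul]
    rw [hfirst, hsecond, hthird, key, smul_smul,
      show occBasis d - ((N : ℂ)⁻¹ * (d.degree : ℂ)) • occBasis d - (N : ℂ)⁻¹ • (((E * E : ℝ) : ℂ) • occBasis d)
        = ((1 : ℂ) - (N : ℂ)⁻¹ * (d.degree : ℂ) - (N : ℂ)⁻¹ * ((E * E : ℝ) : ℂ)) • occBasis d by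
        rw [smul_smul, sub_smul, sub_smul, one_smul]]
    congr 1
    have hreal : (A * B) * (B * A) - (C * E) * (E * C) =
        1 - (N : ℝ)⁻¹ * d.degree - (N : ℝ)⁻¹ * (E * E) := by
      have e1 : (A * B) * (B * A) = (A * A) * (B * B) := by ring
      have e2 : (C * E) * (E * C) = (E * E) * (C * C) := by ring
      rw [e1, e2, sA, sB, sC, sE]
      field_simp
      ring
    have := congrArg (fun r : ℝ => (r : ℂ)) hreal
    push_cast at this ⊢
    exact this
  · ----------------------------------------------------------------- off-diagonal case `p ≠ q`
    rw [if_neg hpq]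
    show bAnnih N p (bCreate N q (occBasis d)) - bCreate N q (bAnnih N p (occBasis d)) =
      (0 : FockSpace ι) - (N : ℂ)⁻¹ • crAnOp N q p (occBasis d)
    by_cases hp : 1 ≤ d p
    · -- `d_p ≥ 1`: everything is a multiple of `|d - e_p + e_q⟩`
      have hdeg1 : 1 ≤ d.degree := hp.trans (apply_le_degree d p)
      set d' : ι →₀ ℕ := d - Finsupp.single p 1 + Finsupp.single q 1 with hd'
      have hqp : (Finsupp.single q 1 : ι →₀ ℕ) p = 0 := Finsupp.single_eq_of_ne hpq
      have hpq' : (Finsupp.single p 1 : ι →₀ ℕ) q = 0 := Finsupp.single_eq_of_ne (Ne.symm hpq)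
      have hfirst : bAnnih N p (bCreate N q (occBasis d)) = (((F * B) * (B * E) : ℝ) : ℂ) • occBasis d' := by
        rcases lt_or_eq_of_le hd with hD | hD
        · rw [bCreate_occBasis N q hD, map_smul, bAnnih_occBasis N p (by rw [degree_add_single]; omega)
            (by simp only [Finsupp.coe_add, Pi.add_apply, hqp]; omega),
            add_single_tsub_single_comm hp, smul_smul, ← Complex.ofReal_mul, mul_comm]
          congr 2
          simp only [degree_add_single, Finsupp.coe_add, Pi.add_apply, hqp, add_zero]
          push_cast
          rw [r1, hF, hB, hE]
          ring
        · rw [bCreate_occBasis_of_le N q hD.ge, map_zero]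
          have hB0 : B = 0 := by rw [hB, hD, sub_self, zero_div, Real.sqrt_zero]
          rw [hB0, mul_zero, zero_mul, Complex.ofReal_zero, zero_smul]
      have hsecond : bCreate N q (bAnnih N p (occBasis d)) = (((C * E) * (F * C) : ℝ) : ℂ) • occBasis d' := by
        rw [bAnnih_occBasis N p hd hp, map_smul,
          bCreate_occBasis N q (by rw [degree_tsub_single hp]; omega), smul_smul, ← Complex.ofReal_mul, mul_comm]
        congr 2
        rw [degree_tsub_single hp]
        simp only [Finsupp.coe_tsub, Pi.sub_apply, hpq', tsub_zero]
        push_cast [Nat.cast_sub hdeg1]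
        rw [r2, hC, hE, hF]
        ring
      have hthird : crAnOp N q p (occBasis d) = ((F * E : ℝ) : ℂ) • occBasis d' := by
        rw [crAnOp_occBasis N q p hd hp]
        congr 2
        simp only [Finsupp.coe_add, Finsupp.coe_tsub, Pi.add_apply, Pi.sub_apply, hpq',
          Finsupp.single_eq_same, tsub_zero]
        push_cast
        rfl
      rw [hfirst, hsecond, hthird, zero_sub, key, smul_smul, ← neg_smul]
      congr 1
      have hreal : (F * B) * (B * E) - (C * E) * (F * C) = -((N : ℝ)⁻¹ * (F * E)) := by
        have e1 : (F * B) * (B * E) = F * E * (B * B) := by ring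
        have e2 : (C * E) * (F * C) = F * E * (C * C) := by ring
        rw [e1, e2, sB, sC]
        field_simp
        ring
      have := congrArg (fun r : ℝ => (r : ℂ)) hreal
      push_cast at this ⊢
      exact this
    · -- `d_p = 0`: both sides vanish
      rw [not_le, Nat.lt_one_iff] at hp
      rw [bAnnih_occBasis_of_eq_zero N p hp, map_zero, sub_zero, crAnOp_occBasis_of_eq_zero N q p hp, smul_zero,
        sub_zero]
      rcases lt_or_eq_of_le hd with hD | hD
      · rw [bCreate_occBasis N q hD, map_smul, bAnnih_occBasis_of_eq_zero N p ?_, smul_zero]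
        simp only [Finsupp.coe_add, Pi.add_apply, Finsupp.single_eq_of_ne hpq, hp, add_zero]
      · rw [bCreate_occBasis_of_le N q hD.ge, map_zero]

end CCR

end Literature.MathematicalPhysics.QuantumManyBody.BoseGas.Fock
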